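import Summits.QuantumFields.YangMills.Theorems.TwistedTraceScaling.Negative.CoreWindowActionFloor
import Summits.QuantumFields.YangMills.Theorems.LuscherReductionTwistedTraceScalingBTWindow
import HarnessLib

/-!
# R55B (crux `TwistedTraceScaling`, stmt-QuantumFields-20203): the (C4) window box is EXACTLY `p ≤ 1/5`, `q ≤ 4/5` — sufficiency of the exponent windows for `BOBricks.hcore`,
# the quaternion-clause exponent cap, and the two-sided action scale of the core

Standing disprover `ym-cdisprove-20203-1` (gen 44); sequel of R54 (`…Negative.CoreWindowLedger.input_radius_of_hcore`: `hcore` forces the input radius `δu ≥ (13/4)(L³β)^{-1/5}`)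
and R55 (`…Negative.CoreWindowActionFloor.action_exponent_le_of_hcore`: an action ceiling `L³S ≤ S₀·powScale q β` on a window containing the core forces `q ≤ 4/5`).
This file closes the ledger into an IFF for the window family lane A (`ym-luscher-20007-p1`, `pub/ym-fleet/ym-luscher-20007-p1/HANDOFF-g19.md` step (1)) actually uses,
`W(β) = {u : ∀ e, ‖q(u_e) − 1‖ ≤ A·powScale p β ∧ L³·S(u) ≤ S₀·powScale q β}`:
* §1 `window_of_orbitDist_lt` — `orbitDist u < ρ ⇒ (∀ e, ‖q(u_e) − 1‖ ≤ ρ) ∧ S(u) ≤ 12ρ⁴` (lane A's `…BTWindow.norm_su2Quat_sub_one_le_orbitDist` + `wilsonAction_one_site_le`, packaged);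
* §2 ★ `core_action_two_sided` — eventually the core `{orbitDist < R}`, `R = 13(L³β)^{-1/5}`, contains a configuration with `L³S ≥ L³R⁴/64` (R55) and EVERY core configuration has
  `L³S ≤ 12·L³R⁴`: the action scale of the core is pinned to `L³R⁴ ≍ L^{3/5}β^{-4/5}` within the absolute factor `768`;
* §3 ★★ `hcore_of_exponents` — `p < 1/5`, `q < 4/5`, ANY amplitudes `A, S₀ > 0` ⇒ `∀ᶠ β, core ⊆ W(β)`, i.e. `BOBricks.hcore` HOLDS for the exponent windows (lane A's announced design
  `p = s ∈ (1/6, 1/5)`, `q = 2s ∈ (1/3, 2/5)` is inside); `hcore_of_exponents_crit` — the boundary `p = 1/5` also works when `A ≥ 13`;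
* §4 ★ `input_exponent_le_of_hcore` — conversely a quaternion clause `‖q(u_{(0,k)}) − 1‖ ≤ A·powScale p β` on a window containing the core forces `p ≤ 1/5` (the exponent form of R54's
  `input_radius_of_hcore`, twin of R55's `action_exponent_le_of_hcore`).
LEDGER (with R54B: `hb_small` needs `p > 1/6`, `q > 1/3`): the admissible box is `1/6 < p ≤ 1/5`, `1/3 < q ≤ 4/5`, open exponents sufficient with any amplitude, the corners needing
amplitude (`A ≥ 13`, resp. `S₀ ≥ 12·13⁴·L^{3/5}`).  No kill: tightness / bookkeeping for the CONDITIONAL route R2b1 (S-BASE bricks); not a gap, not Clay.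
-/

set_option autoImplicit false

noncomputable section

open Real Filter Topology
open Literature.MathematicalPhysics.QuantumFieldTheory hiding SU2
open Literature.MathematicalPhysics.QuantumLattice
open Summit.QuantumFields.YangMills.Theorems.FemtoTransferGap
open Summit.QuantumFields.YangMills.Theorems.FemtoTransferGap.TwoLattice
open Summit.QuantumFields.YangMills.Theorems.FemtoTransferGap.TwoLattice.ConstTube (powScale_mul_powScale tendsto_powScale'
  norm_su2Quat_sub_one_le_orbitDist wilsonAction_one_site_le)
open Summit.QuantumFields.YangMills.Theorems.TwistedTraceScaling.Negative

namespace Summit.QuantumFields.YangMills.Theorems.TwistedTraceScaling.Negative.R55B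

/-- §1 **core ⊆ ball-and-action window at its own radius**: `orbitDist u < ρ` gives `‖q(u_e) − 1‖ ≤ ρ` on every link and `S(u) ≤ 12ρ⁴`. [folklore] -/
theorem window_of_orbitDist_lt (u : GaugeConfig 3 1 FemtoTransferGap.SU2) {ρ : ℝ} (h : orbitDist u < ρ) :
    (∀ e : Edge 3 1, ‖su2Quat (u e) - 1‖ ≤ ρ) ∧ wilsonAction su2Rep u ≤ 12 * ρ ^ 4 :=
  have he : ∀ e : Edge 3 1, ‖su2Quat (u e) - 1‖ ≤ ρ := fun e => (norm_su2Quat_sub_one_le_orbitDist u e).trans h.le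
  ⟨he, wilsonAction_one_site_le u he⟩

variable {L : ℕ} [NeZero L]

/-- The core radius is eventually in `(0, 3]`. [folklore] -/
theorem coreRadius_eventually_pos_le_three :
    ∀ᶠ β : ℝ in atTop, 0 < 13 * (((L : ℝ)) ^ 3 * β) ^ (-(1 / 5 : ℝ)) ∧ 13 * (((L : ℝ)) ^ 3 * β) ^ (-(1 / 5 : ℝ)) ≤ 3 := by
  filter_upwards [eventually_gt_atTop (0 : ℝ), (R54.tendsto_coreRadius (L := L)).eventually (eventually_le_nhds (by norm_num : (0 : ℝ) < 3))]
    with β hβ h3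
  exact ⟨R54.coreRadius_pos hβ, h3⟩

/-- §2 ★ **TWO-SIDED ACTION SCALE OF THE CORE**: eventually there is `u` in the core with `L³·R⁴/64 ≤ L³·S(u)` (R55 `exists_core_config`), and every `u` in the core has
`L³·S(u) ≤ 12·L³·R⁴` (`R = 13(L³β)^{-1/5}`). [folklore] -/
theorem core_action_two_sided :
    ∀ᶠ β : ℝ in atTop,
      (∃ u : GaugeConfig 3 1 FemtoTransferGap.SU2, orbitDist u < 13 * (((L : ℝ)) ^ 3 * β) ^ (-(1 / 5 : ℝ)) ∧
          (L : ℝ) ^ 3 * ((13 * (((L : ℝ)) ^ 3 * β) ^ (-(1 / 5 : ℝ))) ^ 4 / 64) ≤ (L : ℝ) ^ 3 * wilsonAction su2Rep u) ∧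
        ∀ u : GaugeConfig 3 1 FemtoTransferGap.SU2, orbitDist u < 13 * (((L : ℝ)) ^ 3 * β) ^ (-(1 / 5 : ℝ)) →
          (L : ℝ) ^ 3 * wilsonAction su2Rep u ≤ 12 * ((L : ℝ) ^ 3 * (13 * (((L : ℝ)) ^ 3 * β) ^ (-(1 / 5 : ℝ))) ^ 4) := by
  have hL : (0 : ℝ) ≤ (L : ℝ) ^ 3 := by positivity
  filter_upwards [coreRadius_eventually_pos_le_three (L := L)] with β hR
  refine ⟨?_, fun u hu => ?_⟩
  · obtain ⟨u, hu, hS⟩ := R55.exists_core_config hR.1 hR.2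
    exact ⟨u, hu, mul_le_mul_of_nonneg_left hS hL⟩
  · have h := (window_of_orbitDist_lt u hu).2
    nlinarith

/-- Radius bookkeeping: for `p < 1/5` and any `A > 0`, eventually `13(L³β)^{-1/5} ≤ A·powScale p β`. [folklore] -/
theorem coreRadius_le_of_exponent_lt {p A : ℝ} (hp : p < 1 / 5) (hA : 0 < A) :
    ∀ᶠ β : ℝ in atTop, 13 * (((L : ℝ)) ^ 3 * β) ^ (-(1 / 5 : ℝ)) ≤ A * powScale p β := by
  have hsmall : ∀ᶠ β : ℝ in atTop, 13 * powScale (1 / 5 - p) β ≤ A := by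
    have ht := (tendsto_powScale' (sub_pos.mpr hp)).const_mul 13
    rw [mul_zero] at ht
    exact ht.eventually (eventually_le_nhds hA)
  filter_upwards [hsmall, eventually_ge_atTop (1 : ℝ)] with β hsm hβ1
  have h15 : powScale (1 / 5) β = powScale (1 / 5 - p) β * powScale p β := by
    rw [powScale_mul_powScale]; congr 1; ring
  calc 13 * (((L : ℝ)) ^ 3 * β) ^ (-(1 / 5 : ℝ)) ≤ 13 * powScale (1 / 5) β := R54.coreRadius_le hβ1
    _ = 13 * powScale (1 / 5 - p) β * powScale p β := by rw [h15]; ring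
    _ ≤ A * powScale p β := mul_le_mul_of_nonneg_right hsm (powScale_pos _ _).le

omit [NeZero L] in
/-- Action bookkeeping: for `q < 4/5` and any `S₀ > 0`, eventually `12·L³·(13(L³β)^{-1/5})⁴ ≤ S₀·powScale q β` (R55 `floor_le_of_exponent_lt` × 768). [folklore] -/
theorem coreActionCeiling_le_of_exponent_lt {q S₀ : ℝ} (hq : q < 4 / 5) (hS : 0 < S₀) :
    ∀ᶠ β : ℝ in atTop, 12 * ((L : ℝ) ^ 3 * (13 * (((L : ℝ)) ^ 3 * β) ^ (-(1 / 5 : ℝ))) ^ 4) ≤ S₀ * powScale q β := by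
  filter_upwards [R55.floor_le_of_exponent_lt (L := L) hq (div_pos hS (by norm_num : (0 : ℝ) < 768))] with β h
  linarith

/-- §3 ★★ **THE EXPONENT WINDOWS CONTAIN THE CORE** (`BOBricks.hcore` discharged): `p < 1/5`, `q < 4/5`, any amplitudes `A, S₀ > 0` ⇒ eventually every `u` with
`orbitDist u < 13(L³β)^{-1/5}` satisfies `‖q(u_e) − 1‖ ≤ A·powScale p β` on every link and `L³·S(u) ≤ S₀·powScale q β`.  Lane A's announced design `p = s ∈ (1/6,1/5)`,
`q = 2s` is inside. [folklore] -/
theorem hcore_of_exponents {p q A S₀ : ℝ} (hp : p < 1 / 5) (hA : 0 < A) (hq : q < 4 / 5) (hS : 0 < S₀) :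
    ∀ᶠ β : ℝ in atTop, ∀ u : GaugeConfig 3 1 FemtoTransferGap.SU2, orbitDist u < 13 * (((L : ℝ)) ^ 3 * β) ^ (-(1 / 5 : ℝ)) →
      (∀ e : Edge 3 1, ‖su2Quat (u e) - 1‖ ≤ A * powScale p β) ∧ (L : ℝ) ^ 3 * wilsonAction su2Rep u ≤ S₀ * powScale q β := by
  filter_upwards [coreRadius_le_of_exponent_lt (L := L) hp hA, coreActionCeiling_le_of_exponent_lt (L := L) hq hS, core_action_two_sided (L := L)]
    with β hr ha h2 u hu
  exact ⟨fun e => ((window_of_orbitDist_lt u hu).1 e).trans hr, (h2.2 u hu).trans ha⟩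

/-- §3' the critical input exponent `p = 1/5` also contains the core when the amplitude is at least `13` (`q < 4/5`, any `S₀ > 0`). [folklore] -/
theorem hcore_of_exponents_crit {q A S₀ : ℝ} (hA : 13 ≤ A) (hq : q < 4 / 5) (hS : 0 < S₀) :
    ∀ᶠ β : ℝ in atTop, ∀ u : GaugeConfig 3 1 FemtoTransferGap.SU2, orbitDist u < 13 * (((L : ℝ)) ^ 3 * β) ^ (-(1 / 5 : ℝ)) →
      (∀ e : Edge 3 1, ‖su2Quat (u e) - 1‖ ≤ A * powScale (1 / 5) β) ∧ (L : ℝ) ^ 3 * wilsonAction su2Rep u ≤ S₀ * powScale q β := by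
  filter_upwards [eventually_ge_atTop (1 : ℝ), coreActionCeiling_le_of_exponent_lt (L := L) hq hS, core_action_two_sided (L := L)] with β hβ1 ha h2 u hu
  have hr : 13 * (((L : ℝ)) ^ 3 * β) ^ (-(1 / 5 : ℝ)) ≤ A * powScale (1 / 5) β :=
    (R54.coreRadius_le hβ1).trans (mul_le_mul_of_nonneg_right hA (powScale_pos _ _).le)
  exact ⟨fun e => ((window_of_orbitDist_lt u hu).1 e).trans hr, (h2.2 u hu).trans ha⟩

/-- §4 ★ **`hcore` CAPS THE INPUT EXPONENT AT `1/5`**: if the window contains the core and carries a quaternion clause `‖q(u_{(0,k)}) − 1‖ ≤ A·powScale p β`, then `p ≤ 1/5`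
(R54 `input_radius_of_hcore` in exponent form; with R54B the input band is `1/6 < p ≤ 1/5`). [folklore] -/
theorem input_exponent_le_of_hcore {𝒰 : ℝ → Set (GaugeConfig 3 1 FemtoTransferGap.SU2)} {p A : ℝ}
    (hcore : ∀ᶠ β : ℝ in atTop, ∀ u : GaugeConfig 3 1 FemtoTransferGap.SU2, orbitDist u < 13 * (((L : ℝ)) ^ 3 * β) ^ (-(1 / 5 : ℝ)) → u ∈ 𝒰 β)
    (hwin : ∀ᶠ β : ℝ in atTop, ∀ u ∈ 𝒰 β, ∀ k : Fin 3, ‖su2Quat (u (0, k)) - 1‖ ≤ A * powScale p β) : p ≤ 1 / 5 := by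
  by_contra hp
  rw [not_le] at hp
  set C : ℝ := 13 / 4 * ((L : ℝ) ^ 3) ^ (-(1 / 5 : ℝ)) with hC
  have hC0 : 0 < C := by
    have hL : (0 : ℝ) < (L : ℝ) ^ 3 := pow_pos (by exact_mod_cast Nat.pos_of_ne_zero (NeZero.ne L)) 3
    have := Real.rpow_pos_of_pos hL (-(1 / 5 : ℝ))
    positivity
  have hsmall : ∀ᶠ β : ℝ in atTop, (|A| + 1) * powScale (p - 1 / 5) β < C := by
    have ht := (tendsto_powScale' (sub_pos.mpr hp)).const_mul (|A| + 1)
    rw [mul_zero] at ht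
    exact ht.eventually (eventually_lt_nhds hC0)
  obtain ⟨β, hfl, hsm, hβ1⟩ := ((R54.input_radius_of_hcore hcore hwin).and (hsmall.and (eventually_ge_atTop (1 : ℝ)))).exists
  have hp0 : 0 < powScale (1 / 5) β := powScale_pos _ _
  have hpq0 : 0 ≤ powScale (p - 1 / 5) β := (powScale_pos _ _).le
  have hq' : powScale p β = powScale (1 / 5) β * powScale (p - 1 / 5) β := by
    rw [powScale_mul_powScale]; congr 1; ring
  have h1 : C * powScale (1 / 5) β ≤ A * powScale p β := by
    have : C * powScale (1 / 5) β = 13 / 4 * (((L : ℝ)) ^ 3 * β) ^ (-(1 / 5 : ℝ)) := by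
      have h := R54.coreRadius_eq (L := L) hβ1
      rw [hC]; linarith
    rw [this]; exact hfl
  have h2 : A * powScale p β ≤ (|A| + 1) * powScale (p - 1 / 5) β * powScale (1 / 5) β := by
    rw [hq']
    nlinarith [le_abs_self A, mul_nonneg hpq0 hp0.le]
  have h3 : (|A| + 1) * powScale (p - 1 / 5) β * powScale (1 / 5) β < C * powScale (1 / 5) β := mul_lt_mul_of_pos_right hsm hp0
  linarith

/-- Numbers for the box: lane A's design exponents `s = p ∈ (1/6, 1/5)`, `q = 2s ∈ (1/3, 2/5)` sit strictly inside `1/6 < p ≤ 1/5`, `1/3 < q ≤ 4/5` (e.g. `s = 3/16`);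
`768 = 12·64`. -/
example : (1 : ℝ) / 6 < 3 / 16 ∧ (3 : ℝ) / 16 < 1 / 5 ∧ (1 : ℝ) / 3 < 2 * (3 / 16) ∧ 2 * ((3 : ℝ) / 16) < 4 / 5 ∧ (768 : ℝ) = 12 * 64 := by norm_num

end Summit.QuantumFields.YangMills.Theorems.TwistedTraceScaling.Negative.R55B

end
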